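import Literature.MathematicalPhysics.QuantumManyBody.CCRPolynomialStates

/-!
# Quasi-free phonon states: the CCR algebra of linearised superfluid hydrodynamics, its Galilean
# structure, local stability, and the (boosted) Fock vacua

Topic `MathematicalPhysics/QuantumManyBody`, namespace `Literature.MathematicalPhysics.QuantumManyBody`
with the model sub-namespace `Phonon`; the abstract layer (states of `CCR^pol(S, σ)`, quasi-free
states, Bogoliubov maps, quasi-free derivations `[H, ·]`, ground states) is `CCRPolynomialStates.lean`.

Test functions are real Schwartz functions on `ℝᵈ` (`EuclideanSpace ℝ (Fin d)`); `S = 𝓢 × 𝓢 ∋ (f, g)`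
labels the smeared field `Φ(f, g) = δρ(f) + θ(g)` of the density fluctuation `δρ` and the phase `θ`
(velocity potential, `v = ∇θ/m`), canonically conjugate: `[δρ(f), θ(g)] = i ∫ f g`,
`[δρ, δρ] = [θ, θ] = 0`, i.e. `σ((f₁,g₁),(f₂,g₂)) = ∫ (f₁g₂ - f₂g₁)` (`phononForm`; Popov (19.11): the
term `iπ∂_τφ` of the hydrodynamic action; Pethick–Smith (7.14) and p. 272: "the density `n` and the
phase `φ` times `ħ` are canonically conjugate variables"). The Landau–Popov hydrodynamic Hamiltonian
(Popov (19.12), `ħ = 1`, quantum-pressure term dropped)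
`H = ∫ ((ρ + δρ)/2m)|∇θ|² + (mc²/2ρ) δρ²` has the quadratic part `H₀ = ½ ∫ (A|∇θ|² + B δρ²)`,
`A = ρ/m`, `B = mc²/ρ = ∂μ/∂ρ` (`SuperfluidData.stiffness/incompressibility`), whose Heisenberg
equations are the linearised continuity and Josephson equations `δρ̇ = -AΔθ`, `θ̇ = -Bδρ`
(Pethick–Smith (7.8), (7.20)–(7.22)), phonons of speed `c = √(AB)`; and the cubic vertex
`(1/2m) δρ|∇θ|²`. The cubic vertex does NOT act on polynomials in smeared fields (it is a Wick
polynomial with a distributional kernel; the Fock vacuum of `H₀` is not even stationary for it), and it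
enters here only through its linearisation about a uniform flow `∇θ = q = m v`:
`(1/2m)δρ|q + ∇θ'|² = (1/m) δρ q·∇θ' + …`, and `∫ (1/m) δρ q·∇θ' = v·P` with `P = ∫ δρ ∇θ'` the
momentum of the fluctuations — Galilean covariance: in a frame where the fluid moves with `v` the
energy is `E + p·v + ½Mv²` (Pethick–Smith (10.1)–(10.4)). Hence the family of quasi-free dynamics
`phononDerivation P v = [H₀ + v·P, ·]` indexed by the frame velocity, with one-particle generator
`D_v(f,g) = (-Bg + ∂_v f, -AΔf + ∂_v g)` (`phononGenerator`; `(d/dt)Φ(F) = Φ(D_v F)`), and: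

* `translate a` (`(f,g) ↦ (f(· - a), g(· - a))`; the translation automorphism is
  `CCR.bogoliubovMap (translate a)`), `IsTranslationInvariant`;
* `boostCharacter q` (`χ_q(f,g) = ∫ ⟪q,x⟫ g(x) dx`): the Galilean boost to momentum `q` per particle,
  `θ ↦ θ + ⟪q,·⟫`, `δρ ↦ δρ`, is the Bogoliubov translation `CCR.bogoliubovShift (boostCharacter q)`;
  it commutes with `[H₀, ·]` (`χ_q ∘ D₀ = 0` as `Δ⟪q,·⟫ = 0`), which is why the Landau restriction
  below involves the frame velocity and not `[H₀, ·]` alone;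
* `IsLocal` (compactly supported test data) and `IsGaugeInvariant` (`∫ g = 0`: invariance under the
  global phase rotation `θ ↦ θ + α`, i.e. only phase DIFFERENCES are smeared; on such data the central
  terms `χ(D_v F)1` produced by conjugating `[H₀ + v·P, ·]` with a boost vanish), and
  `IsLocallyStable P v ω := CCR.IsGroundStateOn (IsLocal ∧ IsGaugeInvariant) (phononDerivation P v) ω`;
* `vacuumCovariance P` — the two-point form `η₀` of the Fock vacuum of `H₀` (ground state of the mode
  oscillators `H_k = ½(B|δρ_k|² + A k²|θ_k|²)`: `⟨|δρ_k|²⟩ = √(A/B)|k|/2`, `⟨|θ_k|²⟩ = √(B/A)/(2|k|)`,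
  `⟨δρθ + θδρ⟩ = 0`, written with Mathlib's unitary Fourier transform, `k = 2πξ`);
  `IsBoostedVacuum P q ω` (quasi-free, mean `χ_q`, covariance `η₀`: the state `ω₀ ∘ α_q`, a Bogoliubov
  translation leaving the truncated two-point function unchanged, Verbeure §2.3),
  `IsFockVacuum P = IsBoostedVacuum P 0`;
* `QuasiFreePhononState d` — the quasi-free states of the phonon CCR algebra.

Proved API: unfolding lemmas, antisymmetry of `phononForm`, and `phononGenerator_skew`: `D_v` is
infinitesimally symplectic, `σ(D_v F, G) + σ(F, D_v G) = 0` (integration by parts), which is what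
makes `[H₀ + v·P, ·]` compatible with the CCR. NOT here (no named facts introduced): that `η₀` is the
covariance of a state (DG Prop. 17.5) and the uniqueness of the translation-invariant ground state;
Landau's criterion (Pethick–Smith §10.1, (10.5)–(10.6): the excitation energies of `H₀ + v·P` are
`c|k| + v·k ≥ 0` for all `k` iff `‖v‖ ≤ c`, so the boosted vacuum of momentum `q` is expected to be
`IsLocallyStable P (q/m)` iff `‖q‖ ≤ m c`, while every boosted vacuum is a ground state of
`[H₀, ·]`); the cubic vertex as an operator; infrared facts depending on `d` (`vacuumCovariance` is a
Bochner integral, finite for Schwartz data iff the `‖ξ‖⁻¹` singularity is integrable, i.e. `d ≥ 2`,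
junk value `0` otherwise); positive temperature (KMS).

Anchors: `SchwartzMap` (`pairing`, `integralCLM`, `compSubConstCLM`, `smulLeftCLM`, the `LineDeriv`
/ `Laplacian` notation classes `∂_{v}`, `Δ` and their integration by parts), `Real.fourier` (`𝓕`).

## References

* [Popov1983] V. N. Popov, Functional Integrals in Quantum Field Theory and Statistical Physics,
  Reidel 1983: §19, (19.7)–(19.8), (19.11)–(19.12) (Landau's hydrodynamic Hamiltonian and action in
  the density–phase variables, with the vertex `π(∇φ)²/2m`).
* [PethickSmith2008] C. J. Pethick, H. Smith, Bose–Einstein Condensation in Dilute Gases, 2nd ed.,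
  CUP 2008: §7.1 (7.8)–(7.22); §10.1 (10.1)–(10.6) (Galilean transformation, Landau criterion); p. 272.
* [Verbeure2011] A. F. Verbeure, Many-Body Boson Systems, Springer 2011: §2.3 (2.15), (2.21)–(2.22),
  Def. 2.2, Def. 3.7.
* [DerezinskiGerard2022] J. Dereziński, C. Gérard, Mathematics of Quantization and Quantum Fields:
  Def. 8.21, Def. 8.42, Prop. 17.4–17.5.
-/

noncomputable section

open scoped BigOperators ComplexConjugate

namespace Literature.MathematicalPhysics.QuantumManyBody

namespace Phonon

open SchwartzMap MeasureTheory
open scoped LineDeriv Laplacian FourierTransform RealInnerProductSpace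

/-- Configuration space `ℝᵈ`. [folklore] -/
abbrev Space (d : ℕ) : Type := EuclideanSpace ℝ (Fin d)

/-- Real test functions on `ℝᵈ` (Schwartz space). [folklore] -/
abbrev TestFunction (d : ℕ) : Type := SchwartzMap (Space d) ℝ

/-- The phonon test space `S = 𝓢 × 𝓢`: `(f, g)` labels the field `Φ(f,g) = δρ(f) + θ(g)`.
[cite: Popov1983, §19 (19.11)] -/
abbrev TestSpace (d : ℕ) : Type := TestFunction d × TestFunction d

variable {d : ℕ}

/-- Products of test functions are integrable. [folklore] -/
theorem integrable_mul (f g : TestFunction d) :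
    Integrable (fun x => f x * g x) (volume : Measure (Space d)) :=
  (pairing (ContinuousLinearMap.mul ℝ ℝ) f g).integrable

/-- The `L²` pairing `⟪f, g⟫ = ∫ f g` of real test functions, as a bilinear form. [folklore] -/
def l2Form : LinearMap.BilinForm ℝ (TestFunction d) :=
  LinearMap.mk₂ ℝ (fun f g => ∫ x, f x * g x)
    (fun f₁ f₂ g => by
      simp only [add_apply, add_mul]
      exact integral_add (integrable_mul f₁ g) (integrable_mul f₂ g))
    (fun a f g => by
      simp only [smul_apply, smul_eq_mul, mul_assoc]
      exact integral_const_mul a _)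
    (fun f g₁ g₂ => by
      simp only [add_apply, mul_add]
      exact integral_add (integrable_mul f g₁) (integrable_mul f g₂))
    (fun a f g => by
      simp only [smul_apply, smul_eq_mul, mul_left_comm _ a]
      exact integral_const_mul a _)

/-- `l2Form f g = ∫ f g`. [folklore] -/
@[simp] theorem l2Form_apply (f g : TestFunction d) : l2Form f g = ∫ x, f x * g x := rfl

/-- The symplectic form of the density–phase pair, `σ((f₁,g₁),(f₂,g₂)) = ∫ (f₁g₂ - f₂g₁)`, i.e.
`[δρ(f), θ(g)] = i∫fg`, `[δρ, δρ] = [θ, θ] = 0`. [cite: Popov1983, §19 (19.11)] -/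
def phononForm (d : ℕ) : LinearMap.BilinForm ℝ (TestSpace d) :=
  l2Form.compl₁₂ (LinearMap.fst ℝ _ _) (LinearMap.snd ℝ _ _) -
    l2Form.compl₁₂ (LinearMap.snd ℝ _ _) (LinearMap.fst ℝ _ _)

/-- `σ(F, G) = ∫ f₁g₂ - ∫ f₂g₁`. [cite: Popov1983, §19 (19.11)] -/
theorem phononForm_apply (F G : TestSpace d) :
    phononForm d F G = (∫ x, F.1 x * G.2 x) - ∫ x, G.1 x * F.2 x := by
  simp [phononForm, mul_comm]

/-- `σ` is antisymmetric. [folklore] -/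
theorem phononForm_antisymm (F G : TestSpace d) : phononForm d F G = -phononForm d G F := by
  rw [phononForm_apply, phononForm_apply]; ring

/-- `σ` is alternating, as `CCR.State σ` requires (`ccr` with `X = Y = 1`, `F = G` forces `σ(F,F) = 0`;
remark of the reviewer of `CCRPolynomialStates`). [folklore] -/
theorem phononForm_self (F : TestSpace d) : phononForm d F F = 0 := by
  have h := phononForm_antisymm F F
  linarith

/-- Parameters of the superfluid at `T = 0`: particle mass `m`, density `ρ`, sound speed `c`, all
positive. [cite: PethickSmith2008, §10.1] -/
structure SuperfluidData where
  /-- particle mass `m` -/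
  mass : ℝ
  /-- (superfluid = total, at `T = 0`) particle density `ρ` -/
  density : ℝ
  /-- speed of sound `c` -/
  sound : ℝ
  /-- `0 < m` -/
  mass_pos : 0 < mass
  /-- `0 < ρ` -/
  density_pos : 0 < density
  /-- `0 < c` -/
  sound_pos : 0 < sound

namespace SuperfluidData

/-- Phase stiffness `A = ρ/m`, the coefficient of `½|∇θ|²` in `H₀`. [cite: Popov1983, §19 (19.12)] -/
def stiffness (P : SuperfluidData) : ℝ := P.density / P.mass

/-- Inverse compressibility `B = ∂μ/∂ρ = mc²/ρ`, the coefficient of `½δρ²` in `H₀` (Popov's `t₀`).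
[cite: Popov1983, §19 (19.12)] -/
def incompressibility (P : SuperfluidData) : ℝ := P.mass * P.sound ^ 2 / P.density

/-- `A > 0`. [folklore] -/
theorem stiffness_pos (P : SuperfluidData) : 0 < P.stiffness := div_pos P.density_pos P.mass_pos

/-- `B > 0`. [folklore] -/
theorem incompressibility_pos (P : SuperfluidData) : 0 < P.incompressibility :=
  div_pos (mul_pos P.mass_pos (pow_pos P.sound_pos 2)) P.density_pos

/-- `A B = c²` (the phonon dispersion is `ω = √(AB)|k| = c|k|`). [cite: PethickSmith2008, §7.1] -/
theorem stiffness_mul_incompressibility (P : SuperfluidData) :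
    P.stiffness * P.incompressibility = P.sound ^ 2 := by
  have := P.mass_pos.ne'; have := P.density_pos.ne'
  unfold stiffness incompressibility; field_simp

end SuperfluidData

/-- The one-particle generator `D_v(f,g) = (-Bg + ∂_v f, -AΔf + ∂_v g)` of linearised hydrodynamics
in the frame in which the fluid flows with velocity `v` (`H₀ + v·P`): `(d/dt)Φ(F) = Φ(D_v F)`, i.e.
`δρ̇ = -AΔθ - v·∇δρ`, `θ̇ = -Bδρ - v·∇θ` smeared against `(f, g)` (continuity and Josephson equations
plus the transport/Doppler term). [cite: PethickSmith2008, §7.1 (7.8), (7.20)–(7.22), §10.1 (10.4)] -/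
def phononGenerator (P : SuperfluidData) (v : Space d) : TestSpace d →L[ℝ] TestSpace d :=
  let π₁ := ContinuousLinearMap.fst ℝ (TestFunction d) (TestFunction d)
  let π₂ := ContinuousLinearMap.snd ℝ (TestFunction d) (TestFunction d)
  let Dv := LineDeriv.lineDerivOpCLM ℝ (TestFunction d) v
  let L := LineDeriv.laplacianCLM ℝ (Space d) (TestFunction d)
  ContinuousLinearMap.prod (Dv.comp π₁ - P.incompressibility • π₂)
    ((-P.stiffness) • L.comp π₁ + Dv.comp π₂)

/-- Components of `D_v`. [folklore] -/
theorem phononGenerator_apply (P : SuperfluidData) (v : Space d) (F : TestSpace d) :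
    phononGenerator P v F =
      (∂_{v} F.1 - P.incompressibility • F.2, -(P.stiffness • Δ F.1) + ∂_{v} F.2) := by
  simp [phononGenerator, neg_smul]

/-- The **phonon dynamics** `δ_v = [H₀ + v·P, ·]` on `ℂ⟨S⟩`: the quasi-free derivation of the
quadratic hydrodynamic Hamiltonian `H₀ = ½∫(A|∇θ|² + Bδρ²)` plus the Galilean term `v·P`,
`P = ∫ δρ∇θ` (the linearisation about the uniform flow `∇θ = m v` of the vertex `(1/2m)δρ|∇θ|²` of
Popov (19.12)). [cite: Popov1983, §19 (19.12)] -/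
def phononDerivation (P : SuperfluidData) (v : Space d) : CCR.FieldDerivation (TestSpace d) :=
  CCR.quasiFreeDerivation (phononGenerator P v : TestSpace d →ₗ[ℝ] TestSpace d) 0

/-- Space translation of test data, `(f,g) ↦ (f(· - a), g(· - a))`; `CCR.bogoliubovMap (translate a)`
is the translation automorphism `Φ(F) ↦ Φ(F(· - a))`. [cite: DerezinskiGerard2022, Def. 8.42] -/
def translate (a : Space d) : TestSpace d →L[ℝ] TestSpace d :=
  (compSubConstCLM ℝ a).prodMap (compSubConstCLM ℝ a)

/-- Pointwise action of `translate`. [folklore] -/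
@[simp] theorem translate_apply (a : Space d) (F : TestSpace d) (x : Space d) :
    (translate a F).1 x = F.1 (x - a) ∧ (translate a F).2 x = F.2 (x - a) := by
  simp [translate]

/-- The **Galilean boost character** `χ_q(f,g) = ∫ ⟪q, x⟫ g(x) dx`: the boost to momentum `q` per
particle shifts the phase, `θ ↦ θ + ⟪q,·⟫`, and fixes `δρ`, i.e. it is the Bogoliubov translation
`CCR.bogoliubovShift (boostCharacter q)`: `Φ(f,g) ↦ Φ(f,g) + χ_q(f,g)1`.
[cite: PethickSmith2008, §7.1 (7.14) and §10.1 (10.1)] -/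
def boostCharacter (q : Space d) : TestSpace d →L[ℝ] ℝ :=
  (integralCLM ℝ (volume : Measure (Space d))).comp
    ((smulLeftCLM ℝ (fun x : Space d => ⟪q, x⟫)).comp (ContinuousLinearMap.snd ℝ _ _))

/-- `χ_q(f,g) = ∫ ⟪q,x⟫ g(x) dx`. [folklore] -/
theorem boostCharacter_apply (q : Space d) (F : TestSpace d) :
    boostCharacter q F = ∫ x, ⟪q, x⟫ * F.2 x := by
  have hq : (fun x : Space d => ⟪q, x⟫).HasTemperateGrowth :=
    Function.hasTemperateGrowth_inner_right q
  simp [boostCharacter, smulLeftCLM_apply hq]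

/-- Locality of test data: both components compactly supported (`C_c^∞` data). [folklore] -/
def IsLocal (F : TestSpace d) : Prop := HasCompactSupport F.1 ∧ HasCompactSupport F.2

/-- Gauge invariance of test data, `∫ g = 0`: `Φ(f,g)` is invariant under the global phase rotation
`θ ↦ θ + α` (only phase differences / velocities are smeared). [folklore] -/
def IsGaugeInvariant (F : TestSpace d) : Prop := ∫ x, F.2 x = 0

/-- Translation invariance (space homogeneity) of a state of the phonon CCR algebra.
[cite: Verbeure2011, §2.3] -/
def IsTranslationInvariant (ω : CCR.State (phononForm d)) : Prop :=
  ∀ a : Space d, ω.IsInvariant (CCR.bogoliubovMap (translate a : TestSpace d →ₗ[ℝ] TestSpace d))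

/-- **Local stability** of `ω` in the frame with flow velocity `v`: the ground-state inequality
`ω(A*[H₀ + v·P, A]) ≥ 0` for every polynomial `A` in fields smeared with local, gauge-invariant test
data. [cite: Verbeure2011, Def. 3.7] -/
def IsLocallyStable (P : SuperfluidData) (v : Space d) (ω : CCR.State (phononForm d)) : Prop :=
  CCR.IsGroundStateOn (fun F => IsLocal F ∧ IsGaugeInvariant F) (phononDerivation P v) ω

/-- The **vacuum covariance** `η₀(F, G)` of the quadratic theory `H₀`: per Fourier mode the ground
state of `H_k = ½(B|δρ_k|² + Ak²|θ_k|²)` has `⟨|δρ_k|²⟩ = √(A/B)|k|/2`, `⟨|θ_k|²⟩ = √(B/A)/(2|k|)`,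
`⟨δρθ + θδρ⟩ = 0`; with Mathlib's unitary Fourier transform (`k = 2πξ`),
`η₀ = ∫ [√(A/B) π‖ξ‖ Re(f̂₁ conj f̂₂) + √(B/A) (4π‖ξ‖)⁻¹ Re(ĝ₁ conj ĝ₂)] dξ` (a Bochner integral;
the `‖ξ‖⁻¹` singularity is integrable iff `d ≥ 2`). [cite: Verbeure2011, §2.3 (2.17)–(2.21)] -/
def vacuumCovariance (P : SuperfluidData) (F G : TestSpace d) : ℝ :=
  ∫ ξ : Space d,
    (Real.sqrt (P.stiffness / P.incompressibility) * (Real.pi * ‖ξ‖) *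
        (𝓕 (fun x => (F.1 x : ℂ)) ξ * conj (𝓕 (fun x => (G.1 x : ℂ)) ξ)).re +
      Real.sqrt (P.incompressibility / P.stiffness) / (4 * Real.pi * ‖ξ‖) *
        (𝓕 (fun x => (F.2 x : ℂ)) ξ * conj (𝓕 (fun x => (G.2 x : ℂ)) ξ)).re)

/-- `ω` **is the vacuum boosted to momentum `q` per particle** (`ω₀ ∘ α_q`): quasi-free, one-point
functional `χ_q`, covariance `η₀` (a Bogoliubov translation does not change the truncated two-point
function, Verbeure §2.3). Existence is NOT asserted here. [cite: Verbeure2011, §2.3 (2.21)–(2.22)] -/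
structure IsBoostedVacuum (P : SuperfluidData) (q : Space d) (ω : CCR.State (phononForm d)) :
    Prop where
  /-- `ω` is quasi-free -/
  quasiFree : ω.IsQuasiFree
  /-- its one-point functional is the boost character `χ_q` -/
  mean_eq : ∀ F, ω (CCR.phi F) = boostCharacter q F
  /-- its covariance is the vacuum covariance `η₀` -/
  covariance_eq : ∀ F G, ω.covariance F G = vacuumCovariance P F G

/-- `ω` is the Fock vacuum of `H₀` (the phonon vacuum at rest). [cite: Verbeure2011, §2.3 (2.21)] -/
def IsFockVacuum (P : SuperfluidData) (ω : CCR.State (phononForm d)) : Prop := IsBoostedVacuum P 0 ω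

variable (d) in
/-- **Quasi-free phonon states**: the quasi-free (Gaussian) states of the CCR algebra of the
density–phase fields of linearised superfluid hydrodynamics in `d` space dimensions.
[cite: Verbeure2011, Def. 2.2] -/
def QuasiFreePhononState : Type := {ω : CCR.State (phononForm d) // ω.IsQuasiFree}

/-! ### `D_v` is infinitesimally symplectic -/

/-- `∫ (∂_v f) g = -∫ f (∂_v g)`. [folklore] -/
theorem l2Form_lineDeriv_antisymm (v : Space d) (f g : TestFunction d) :
    l2Form (∂_{v} f) g = -l2Form f (∂_{v} g) := by
  rw [l2Form_apply, l2Form_apply, integral_mul_lineDerivOp_right_eq_neg_left, neg_neg]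

/-- `∫ (Δf) g = ∫ f (Δg)`. [folklore] -/
theorem l2Form_laplacian_symm (f g : TestFunction d) : l2Form (Δ f) g = l2Form f (Δ g) := by
  rw [l2Form_apply, l2Form_apply, integral_mul_laplacian_right_eq_left]

/-- The generator `D_v` of the frame-`v` phonon dynamics is `σ`-skew,
`σ(D_v F, G) + σ(F, D_v G) = 0`, so `[H₀ + v·P, ·]` respects the CCR. [folklore] -/
theorem phononGenerator_skew (P : SuperfluidData) (v : Space d) (F G : TestSpace d) :
    phononForm d (phononGenerator P v F) G + phononForm d F (phononGenerator P v G) = 0 := by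
  obtain ⟨f₁, g₁⟩ := F
  obtain ⟨f₂, g₂⟩ := G
  simp only [phononForm, LinearMap.sub_apply, LinearMap.compl₁₂_apply, LinearMap.fst_apply,
    LinearMap.snd_apply, phononGenerator_apply, map_add, map_sub, map_smul, map_neg,
    LinearMap.add_apply, LinearMap.smul_apply, LinearMap.neg_apply, smul_eq_mul,
    l2Form_lineDeriv_antisymm v f₁ g₂, l2Form_lineDeriv_antisymm v g₁ f₂, l2Form_laplacian_symm f₁ f₂]
  ring

end Phonon

end Literature.MathematicalPhysics.QuantumManyBody
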